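import Literature.NumberTheory.GaloisRepresentations.SemiLocalShapiroInflation
import Literature.NumberTheory.GaloisRepresentations.LocalCanonicalFundamentalClassInflation
import HarnessLib

/-!
# The local invariants of `H²(Gal(·/F), J)` are compatible with inflation: `inv_v(Inf c) = inv_v(c)` at the finite places
# (Tate, C–F VII §9.7 (14), §7.2–§7.3, §11.2; Serre, *Local Fields* XI §2–§3; XIII §3 Prop. 7 for `inv_K` itself)

Topic `NumberTheory/GaloisRepresentations`; namespaces `Literature.NumberTheory.GaloisRepresentations.SemiLocal` (§1) and
`….IdeleCohomology` (§2).  ASSEMBLY of: `IdeleInflation.lean` (`ideleInf : H²(Gal(E/F), J_E) → H²(Gal(E'/F), J_{E'})`),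
`SemiLocalInflation.lean` (`map_placeProj_ideleInf`: the `v`-component of `Inf c` is `H²(res, ι_v)` of the `v`-component of
`c`), `SemiLocalShapiroInflation.lean` (`groupCohomologyUnitsRepIsoAut_semiLocalInf`: Shapiro turns `H²(res, ι_v)` into the
local cochain-level inflation `localInf w'`), `LocalCanonicalFundamentalClassInflation.lean` (`UnitsLayer.layerInv_unitsPairInf`:
`inv_{E'_{w'}/F_v} ∘ Inf = inv_{E_w/F_v}`) and `IdeleLocalInvariantsCanonical.lean` (the invariants do not depend on the
place above `v`).  Definitions with bodies (`inflAlgHom`) and theorems; NO named fact, no `sorry`, no instance, no notation;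
number fields in `Type`.

Mathematics.  For number fields `F ⊆ E ⊆ E'` with `E/F`, `E'/F` Galois, a finite place `v` of `F` and `c ∈ H²(Gal(E/F), J_E)`:
**`inv_v(Inf c) = inv_v(c)`** (`localInv_ideleInf`), where `inv_v` is the local invariant of `IdeleLocalInvariants.lean`
(Tate VII §7.3 Cor. 7.4 (b): `H²(G, J_L) ≅ ⊕_v (1/n_v)ℤ/ℤ`, compatible with `Inf` by §9.7 (14) `inv_v(inf α) = inv_v(α)` — "one reduces this to the corresponding local
statement" — and, locally, the class-formation formalism of Serre XI §2–§3).
Not here: the infinite places (the analogous statement for `localInvInf`), hence not yet `inv(Inf c) = inv(c)` for the sum.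

## What is formalised

* §1 `SemiLocal.adicCompletionOfUnder_algebraMap` (`E_w ⊆ E'_{w'}` is `F_v`-linear), `SemiLocal.inflAlgHom w' :
  E_w →ₐ[F_v] E'_{w'}`, `SemiLocal.inflAlgHom_localRestrict` (the pair `(localRestrict w', inflAlgHom w')` is compatible),
  `SemiLocal.localInf_eq_unitsPairInf`.
* §2 **`IdeleCohomology.localInvAt_ideleInf`**: `localInvAt w' (Inf c) = localInvAt (w' ∩ E) c`;
  **`IdeleCohomology.localInv_ideleInf`**: `localInv E' v (Inf c) = localInv E v c`.

## References
* J. W. S. Cassels, A. Fröhlich (eds.), *Algebraic Number Theory* (1967), Ch. VII (Tate) §7.2–§7.3, §9.7 (14), §11.2.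
  [CasselsFrohlichANT1967]
* J.-P. Serre, *Local Fields*, GTM 67 (1979), Ch. XI §2–§3 (class formations: `inv_E` on the union along the injective
  inflations); Ch. XIII §3 Prop. 7 (the local `inv_K`). [SerreLocalFields1979]
-/

-- CITATION-FIX (2026-08-27, door-c5 g15; referee Q-g51-2 locus-3 belief, V-g52-4; held copies `book:serre1979-local-fields`,
-- `book:editornd-algebraic-number-theory`): earlier revisions cited "Serre XIII §3 Prop. 7 Cor. 1" for the compatibility of
-- `inv` with `Inf` — Cor. 1 [held p0170] is the splitting criterion and XIII §3 has no `Inf` statement; the correct anchors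
-- are Tate VII §9.7 (14) [held p0225: `inv_v(inf α) = inv_v(α)`, "one reduces this to the corresponding local statement"]
-- and Serre XI §2 [held p0149: the inflations are injective for `q = 2` and `inv_E` lives on their union].
-- Declarations unchanged.

noncomputable section

open NumberField IsDedekindDomain CategoryTheory groupCohomology
open Literature.NumberTheory.Automorphic

namespace Literature.NumberTheory.GaloisRepresentations

namespace SemiLocal

open Literature.Algebra.Homology

variable {F E E' : Type} [Field F] [NumberField F] [Field E] [NumberField E] [Field E'] [NumberField E']
  [Algebra F E] [Algebra E E'] [Algebra F E'] [IsScalarTower F E E']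
variable {v : HeightOneSpectrum (𝓞 F)}

/-! ## §1. `E_w ⊆ E'_{w'}` as an `F_v`-algebra map; the compatible pair `(localRestrict w', E_w ⊆ E'_{w'})` -/

/-- **`E_w → E'_{w'}` is `F_v`-linear** (`w = w' ∩ E`): both `F_v → E_w → E'_{w'}` and `F_v → E'_{w'}` are continuous and
extend `F → E → E'`. [cite: CasselsFrohlichANT1967, Ch. II §10] -/
theorem adicCompletionOfUnder_algebraMap (w' : Place F E' v) (c : v.adicCompletion F) :
    adicCompletionOfUnder (𝓞 E) E E' (w' : HeightOneSpectrum (𝓞 E'))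
        (algebraMap (v.adicCompletion F) (((Place.below w' : Place F E v) : HeightOneSpectrum (𝓞 E)).adicCompletion E) c) =
      algebraMap (v.adicCompletion F) ((w' : HeightOneSpectrum (𝓞 E')).adicCompletion E') c := by
  rw [algebraMap_place_eq, algebraMap_place_eq]
  refine congrFun (HeightOneSpectrum.adicCompletion.ext_of_coe F v
    ((continuous_adicCompletionOfUnder E E' (w' : HeightOneSpectrum (𝓞 E'))).comp
      (continuous_adicCompletionOfLiesOver F E v ((Place.below w' : Place F E v) : HeightOneSpectrum (𝓞 E))))
    (continuous_adicCompletionOfLiesOver F E' v (w' : HeightOneSpectrum (𝓞 E'))) fun a => ?_) c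
  change adicCompletionOfUnder (𝓞 E) E E' (w' : HeightOneSpectrum (𝓞 E'))
      (adicCompletionOfLiesOver F E v ((Place.below w' : Place F E v) : HeightOneSpectrum (𝓞 E))
        (a : v.adicCompletion F)) =
    adicCompletionOfLiesOver F E' v (w' : HeightOneSpectrum (𝓞 E')) (a : v.adicCompletion F)
  rw [adicCompletionOfLiesOver_coe, adicCompletionOfLiesOver_coe]
  change adicCompletionOfUnder (𝓞 E) E E' (w' : HeightOneSpectrum (𝓞 E'))
      ((algebraMap F E a : E) : (((w' : HeightOneSpectrum (𝓞 E')).under (𝓞 E)).adicCompletion E)) = _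
  rw [adicCompletionOfUnder_coe, ← IsScalarTower.algebraMap_apply]

/-- **`E_w →ₐ[F_v] E'_{w'}`** (`w = w' ∩ E`), the tree's `adicCompletionOfUnder` as an `F_v`-algebra homomorphism.
[cite: CasselsFrohlichANT1967, Ch. II §10] -/
def inflAlgHom (w' : Place F E' v) :
    ((Place.below w' : Place F E v) : HeightOneSpectrum (𝓞 E)).adicCompletion E →ₐ[v.adicCompletion F]
      (w' : HeightOneSpectrum (𝓞 E')).adicCompletion E' :=
  { adicCompletionOfUnder (𝓞 E) E E' (w' : HeightOneSpectrum (𝓞 E')) with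
    commutes' := adicCompletionOfUnder_algebraMap w' }

/-- Unfolding: `inflAlgHom w'` is `adicCompletionOfUnder`. [cite: CasselsFrohlichANT1967, Ch. II §10] -/
@[simp] theorem inflAlgHom_apply (w' : Place F E' v)
    (y : ((Place.below w' : Place F E v) : HeightOneSpectrum (𝓞 E)).adicCompletion E) :
    inflAlgHom w' y = adicCompletionOfUnder (𝓞 E) E E' (w' : HeightOneSpectrum (𝓞 E')) y := rfl

variable [Normal F E] [IsGalois F E] [IsGalois F E']

/-- **The pair `(localRestrict w', E_w ⊆ E'_{w'})` is compatible**: `(ψ'|_{E_w}) y ↦ ψ' y` under the inclusion.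
[cite: CasselsFrohlichANT1967, Ch. VII §1.1] -/
theorem inflAlgHom_localRestrict (w' : Place F E' v)
    (ψ' : (w' : HeightOneSpectrum (𝓞 E')).adicCompletion E' ≃ₐ[v.adicCompletion F] (w' : HeightOneSpectrum (𝓞 E')).adicCompletion E')
    (y : ((Place.below w' : Place F E v) : HeightOneSpectrum (𝓞 E)).adicCompletion E) :
    inflAlgHom w' (localRestrict w' ψ' y) = ψ' (inflAlgHom w' y) := by
  obtain ⟨g', rfl⟩ := (decompMulEquiv w').surjective ψ'
  rw [inflAlgHom_apply, inflAlgHom_apply, decompMulEquiv_apply w' g', localRestrict_decompAlgEquiv (E := E) w' g',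
    decompAlgEquiv_adicCompletionOfUnder (E := E) w' g']

/-- **The local inflation of `SemiLocalShapiroInflation` is the cochain-level inflation of the compatible pair**
`(localRestrict w', inflAlgHom w')` of `LocalCanonicalFundamentalClassInflation`. [cite: SerreLocalFields1979, Ch. XI §3] -/
theorem localInf_eq_unitsPairInf (w' : Place F E' v) (n : ℕ) :
    localInf (E := E) w' n = UnitsLayer.unitsPairInf (v.adicCompletion F) (inflAlgHom (E := E) w') (localRestrict w')
      (inflAlgHom_localRestrict w') n := by
  rw [localInf, UnitsLayer.unitsPairInf]
  refine map_congr' rfl _ _ (fun x => ?_) n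
  apply (Additive.toMul (α := ((w' : HeightOneSpectrum (𝓞 E')).adicCompletion E')ˣ)).injective
  exact Units.ext rfl

end SemiLocal

/-! ## §2. `inv_v (Inf c) = inv_v (c)` at the finite places -/

namespace IdeleCohomology

open Literature.Algebra.Homology SemiLocal

variable {F E E' : Type} [Field F] [NumberField F] [Field E] [NumberField E] [Field E'] [NumberField E']
  [Algebra F E] [Algebra E E'] [Algebra F E'] [IsScalarTower F E E'] [Normal F E] [IsGalois F E] [IsGalois F E']
variable {v : HeightOneSpectrum (𝓞 F)}

/-- **`inv_v` read at `w'` of the inflated class is `inv_v` read at `w' ∩ E`**: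
`localInvAt w' (Inf c) = localInvAt (w' ∩ E) c` (semi-local Shapiro + `inv ∘ Inf = inv` locally).
[cite: CasselsFrohlichANT1967, Ch. VII §9.7 (14)][cite: SerreLocalFields1979, Ch. XI §2] -/
theorem localInvAt_ideleInf (w' : Place F E' v) (c : groupCohomology (IdeleClassGroup.ideleRep F E) 2) :
    localInvAt w' (ideleInf F E E' 2 c) = localInvAt (Place.below w' : Place F E v) c := by
  haveI : CharZero (v.adicCompletion F) := charZero_of_injective_algebraMap (algebraMap F _).injective
  haveI := finiteDimensional_place (K := F) (Place.below w' : Place F E v)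
  haveI := isGalois_place (F := F) (Place.below w' : Place F E v)
  haveI := finiteDimensional_place (K := F) w'
  haveI := isGalois_place (F := F) w'
  rw [localInvAt_apply, localInvAt_apply, map_placeProj_ideleInf, groupCohomologyUnitsRepIsoAut_semiLocalInf,
    SemiLocal.localInf_eq_unitsPairInf]
  exact UnitsLayer.layerInv_unitsPairInf (v.adicCompletion F) (inflAlgHom w') (localRestrict w')
    (inflAlgHom_localRestrict w') _

/-- **`inv_v(Inf c) = inv_v(c)` at every finite place `v` of `F`** (the canonical `localInv` of both layers).
[cite: CasselsFrohlichANT1967, Ch. VII §9.7 (14)][cite: SerreLocalFields1979, Ch. XI §2] -/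
theorem localInv_ideleInf (v : HeightOneSpectrum (𝓞 F)) (c : groupCohomology (IdeleClassGroup.ideleRep F E) 2) :
    localInv E' v (ideleInf F E E' 2 c) = localInv E v c := by
  rw [localInv_eq_localInvAt (chosenPlace (E := E') v), localInv_eq_localInvAt (Place.below (chosenPlace (E := E') v) : Place F E v)]
  exact localInvAt_ideleInf _ c

end IdeleCohomology

end Literature.NumberTheory.GaloisRepresentations

end
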